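import Literature.NumberTheory.LFunctions.MoebiusWalshAssembly
import Literature.NumberTheory.LFunctions.LiouvilleWalshBoxCriterion
import Literature.NumberTheory.LFunctions.MoebiusWalshCircuitsFourierWalshProofs
import HarnessLib

/-!
# Bourgain 2013, Theorem 1 for the Liouville function from a type-II box bound — proved

Topic `Literature/NumberTheory/LFunctions`, a proofs companion of `MoebiusWalshCircuits.lean`
(named fact `bourgain_liouville_walsh_uniform`: J. Bourgain, *Möbius–Walsh correlation bounds and an
estimate of Mauduit and Rivat*, J. Anal. Math. **119** (2013) 147–163 = arXiv:1109.2784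
[Bourgain2013MoebiusWalsh], Theorem 1 with its parenthesis "(a similar estimate is also valid for the
Liouville function)"). Everything here is PROVED (theorems only; no definition, no named fact,
nothing discharged).

`MoebiusWalsh.bourgain_liouville_walsh_uniform_of_typeII : (∃ c > 0, ∃ C ≥ 0, TypeII c C) → bourgain_liouville_walsh_uniform`,
the Liouville twin of `MoebiusWalsh.bourgain_moebius_walsh_uniform_of_typeII`
(`MoebiusWalshAssembly.lean`), with the SAME inline type-II hypothesis as that theorem. (The
sibling file `LiouvilleWalshAssembly.lean`, namespace `LiouvilleWalsh`, landed concurrently by another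
seat, proves the same reduction from a DIFFERENTLY SHAPED type-II hypothesis — windows `[K, K+i)`,
admissibility `K = 0 ∨ (i ≤ K + ρ ∧ 4ρ < K)`, `K + ρ ≤ j`; the two files give the type-II analysis
of §2 two entry points, and whichever shape it delivers first discharges the fact.) This file uses
the hypothesis (Bourgain's (2.29) for box
sums of Walsh characters with `1`-bounded coefficients; see that file's docstring for its reading
and admissibility conventions). Once that hypothesis is a theorem of the tree, both named facts are
discharged by one-line applications.

Ingredients specific to `λ`: the tree's Vaughan reduction for `λ`
(`LiouvilleWalshVaughan.abs_walshSum_liouville_le_boxes`, through the criterion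
`LiouvilleWalsh.abs_walshSum_liouville_le_of_boxBounds`), whose square term `u⌊√2ⁿ⌋` is absorbed
in `final_numeric_liouville`; the type-I box lemma for a general divisor-bounded coefficient
(`typeI_box_gen`, `typeI_box_of_G_gen`, `abs_boxSum_le_of_divisorBounded` — the proofs of the
Möbius versions verbatim); Green's Proposition 1 for `λ` (tree, proved:
`green_liouville_fourierWalsh_holds`) for `1 ≤ |A| ≤ ⌊√n⌋/⌊n^{1/8}⌋` (`green_small_gen`) and the
constant coefficient through `Green2012.liouville_walshSum_empty_le` (`green_empty_liouville`).
Everything else (schedule, windows, type-II box, the three savings) is imported from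
`MoebiusWalshAssembly.lean`.

## References

* J. Bourgain, J. Anal. Math. 119 (2013) 147–163; arXiv:1109.2784: Theorem 1 (remark on `λ`),
  §2 (2.29)–(2.35), §3 (3.1)–(3.10). [Bourgain2013MoebiusWalsh]
* B. Green, Combin. Probab. Comput. 21 (2012), Proposition 1 and the §1 remark on `λ`. [Green2012]
-/

noncomputable section

open Finset Real Filter
open scoped ArithmeticFunction.sigma

namespace Literature.NumberTheory.LFunctions.MoebiusWalsh

open Literature.NumberTheory.LFunctions.MoebiusWalshVaughan (natWalsh dyBlock mem_dyBlock boxSum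
  abs_natWalsh typeIICoeffA)
open Literature.NumberTheory.LFunctions.LiouvilleWalshVaughan (liouvTypeICoeff abs_liouvTypeICoeff_le
  liouvTypeICoeff_eq_zero liouvTypeIICoeffB abs_liouvTypeIICoeffB_le liouvTypeIICoeffB_eq_zero)

/-! ### The Green side for `λ` -/

/-- **Small digit sets, any function**: the argument of `MoebiusWalsh.green_small` verbatim for a
general `g` (here used with `g = λ`). [cite: Green2012, Proposition 1] -/
theorem green_small_gen {n : ℕ} {g : ℕ → ℤ} {cG KG : ℝ}
    (hG : ∀ S : Finset (Fin n), S.Nonempty →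
      |walshSum g S| / 2 ^ n ≤ KG * S.card * Real.exp (-(cG * Real.sqrt n / S.card)))
    (hcG : 0 < cG) {q₀ : ℕ} (S : Finset (Fin n)) (hS : S.Nonempty)
    (hSq : (S.card : ℝ) * q₀ ≤ Real.sqrt n)
    (hE5 : (n : ℝ) * Real.exp (-(cG * q₀)) * (2 : ℝ) ^ ((n : ℝ) ^ ((1 : ℝ) / 10)) * (|KG| + 1) < 1) :
    |walshSum g S| < (2 : ℝ) ^ ((n : ℝ) - (n : ℝ) ^ ((1 : ℝ) / 10)) := by
  have h := hG S hS
  have hk0 : (0 : ℝ) < S.card := by exact_mod_cast hS.card_pos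
  have hkn : (S.card : ℝ) ≤ n := by
    have : S.card ≤ n := by simpa using S.card_le_univ
    exact_mod_cast this
  have h2n : (0 : ℝ) < 2 ^ n := by positivity
  rw [div_le_iff₀ h2n] at h
  have hexp_le : Real.exp (-(cG * Real.sqrt n / S.card)) ≤ Real.exp (-(cG * q₀)) := by
    rw [Real.exp_le_exp, neg_le_neg_iff]
    have h1 : (q₀ : ℝ) ≤ Real.sqrt n / S.card := by
      rw [le_div_iff₀ hk0]; linarith
    calc cG * q₀ ≤ cG * (Real.sqrt n / S.card) := by gcongr
      _ = cG * Real.sqrt n / S.card := by ring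
  have hmain : |walshSum g S| ≤ (|KG| + 1) * n * Real.exp (-(cG * q₀)) * 2 ^ n := by
    refine h.trans ?_
    have hK : KG ≤ |KG| + 1 := by linarith [le_abs_self KG]
    have h3 : KG * S.card * Real.exp (-(cG * Real.sqrt n / S.card)) ≤
        (|KG| + 1) * S.card * Real.exp (-(cG * Real.sqrt n / S.card)) := by
      gcongr
    have h4 : (|KG| + 1) * S.card * Real.exp (-(cG * Real.sqrt n / S.card)) ≤
        (|KG| + 1) * n * Real.exp (-(cG * q₀)) := by
      gcongr
    nlinarith [h3, h4, h2n]
  have hy : (2 : ℝ) ^ ((n : ℝ) - (n : ℝ) ^ ((1 : ℝ) / 10)) = 2 ^ n / (2 : ℝ) ^ ((n : ℝ) ^ ((1 : ℝ) / 10)) := by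
    rw [Real.rpow_sub (by norm_num), Real.rpow_natCast]
  rw [hy, lt_div_iff₀ (by positivity)]
  calc |walshSum g S| * (2 : ℝ) ^ ((n : ℝ) ^ ((1 : ℝ) / 10))
      ≤ (|KG| + 1) * n * Real.exp (-(cG * q₀)) * 2 ^ n * (2 : ℝ) ^ ((n : ℝ) ^ ((1 : ℝ) / 10)) := by
        gcongr
    _ = ((n : ℝ) * Real.exp (-(cG * q₀)) * (2 : ℝ) ^ ((n : ℝ) ^ ((1 : ℝ) / 10)) * (|KG| + 1)) * 2 ^ n := by ring
    _ < 1 * 2 ^ n := by gcongr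
    _ = 2 ^ n := one_mul _

/-- **The empty digit set for `λ`**: from Green's Proposition 1 for `λ` alone (tree:
`Green2012.liouville_walshSum_empty_le`, `|λ̂ₙ(∅)| ≤ 2K e^{-(c/2)√n}` by the two digit identities),
`|walshSum λ ∅| < 2^{n - n^{1/10}}` as soon as `4(|K|+1) e^{-c√n/2} 2^{n^{1/10}} < 1`.
[cite: Green2012, Proposition 1 (remark on λ)] -/
theorem green_empty_liouville {n : ℕ} {cG KG : ℝ} (hcG : 0 < cG)
    (hG : ∀ n : ℕ, 1 ≤ n → ∀ S : Finset (Fin n), S.Nonempty →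
      |walshSum (fun k => ArithmeticFunction.liouville k) S| / 2 ^ n ≤
        KG * S.card * Real.exp (-(cG * Real.sqrt n / S.card)))
    (hE5' : 4 * (|KG| + 1) * Real.exp (-(cG * Real.sqrt n / 2)) * (2 : ℝ) ^ ((n : ℝ) ^ ((1 : ℝ) / 10)) < 1) :
    |walshSum (fun k => ArithmeticFunction.liouville k) (∅ : Finset (Fin n))| <
      (2 : ℝ) ^ ((n : ℝ) - (n : ℝ) ^ ((1 : ℝ) / 10)) := by
  -- `K ≥ 0` (test the bound at `n = 1`, `S = {0}`)
  have hK : 0 ≤ KG := by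
    have h := hG 1 le_rfl ({0} : Finset (Fin 1)) (by simp)
    have h0 : 0 ≤ |walshSum (fun k => ArithmeticFunction.liouville k) ({0} : Finset (Fin 1))| / 2 ^ 1 := by
      positivity
    have h1 := h0.trans h
    simp only [Finset.card_singleton, Nat.cast_one, mul_one] at h1
    have he : 0 < Real.exp (-(cG * Real.sqrt ((1 : ℕ) : ℝ) / 1)) := Real.exp_pos _
    nlinarith
  have h := Green2012.liouville_walshSum_empty_le hcG.le hK hG n
  have h2n : (0 : ℝ) < 2 ^ n := by positivity
  rw [div_le_iff₀ h2n] at h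
  have hexp : Real.exp (-(cG / 2 * Real.sqrt n)) = Real.exp (-(cG * Real.sqrt n / 2)) := by ring_nf
  rw [hexp] at h
  have hy : (2 : ℝ) ^ ((n : ℝ) - (n : ℝ) ^ ((1 : ℝ) / 10)) = 2 ^ n / (2 : ℝ) ^ ((n : ℝ) ^ ((1 : ℝ) / 10)) := by
    rw [Real.rpow_sub (by norm_num), Real.rpow_natCast]
  rw [hy, lt_div_iff₀ (by positivity)]
  have hK2 : 2 * KG ≤ 4 * (|KG| + 1) := by rw [abs_of_nonneg hK]; linarith
  calc |walshSum (fun k => ArithmeticFunction.liouville k) (∅ : Finset (Fin n))| * (2 : ℝ) ^ ((n : ℝ) ^ ((1 : ℝ) / 10))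
      ≤ 2 * KG * Real.exp (-(cG * Real.sqrt n / 2)) * 2 ^ n * (2 : ℝ) ^ ((n : ℝ) ^ ((1 : ℝ) / 10)) := by
        gcongr
    _ ≤ 4 * (|KG| + 1) * Real.exp (-(cG * Real.sqrt n / 2)) * 2 ^ n * (2 : ℝ) ^ ((n : ℝ) ^ ((1 : ℝ) / 10)) := by
        gcongr
    _ = (4 * (|KG| + 1) * Real.exp (-(cG * Real.sqrt n / 2)) * (2 : ℝ) ^ ((n : ℝ) ^ ((1 : ℝ) / 10))) * 2 ^ n := by
        ring
    _ < 1 * 2 ^ n := by gcongr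
    _ = 2 ^ n := one_mul _

/-! ### A type-I box with a general divisor-bounded coefficient -/

/-- **Cauchy–Schwarz for a divisor-bounded coefficient** (`|α| ≤ τ`):
`|boxSum T i j α 1| ≤ √(2^{i+1}(1+log 2^{i+1})³) √(2^j F)`. This was a verbatim copy of
`LiouvilleWalsh.abs_boxSum_le_sqrt_of_divisorBounded` (`LiouvilleWalshBoxCriterion.lean`, imported);
the name is kept as a deprecated alias (dedup-01053). [cite: Bourgain2013MoebiusWalsh, §3 (3.1)] -/
@[deprecated (since := "2026-08-16")]
alias abs_boxSum_le_of_divisorBounded :=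
  Literature.NumberTheory.LFunctions.LiouvilleWalsh.abs_boxSum_le_sqrt_of_divisorBounded

/-- The type-I coefficient of the `λ`-reduction is divisor bounded. [folklore] -/
theorem liouvHα (u : ℕ) : ∀ a, |liouvTypeICoeff u a| ≤ ((σ 0 a : ℕ) : ℝ) := fun a => abs_liouvTypeICoeff_le u a

/-- From `∑_a |∑_b w_T(ab)| ≤ 2^{i+j} G` with `2(n+1)³ G ≤ 2^{-4q}` to `|box| ≤ 2^{i+j} 2^{-2q}`,
for any divisor-bounded coefficient (general form of `MoebiusWalsh.typeI_box_of_G`). [folklore] -/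
theorem typeI_box_of_G_gen (T : Finset ℕ) {i j n q : ℕ} {G : ℝ} {α : ℕ → ℝ}
    (hα : ∀ a, |α a| ≤ ((σ 0 a : ℕ) : ℝ))
    (hF : ∑ a ∈ dyBlock i, |∑ b ∈ dyBlock j, natWalsh T (a * b)| ≤ 2 ^ (i + j) * G)
    (hG : 2 * ((n : ℝ) + 1) ^ 3 * G ≤ (2 : ℝ) ^ (-(4 * (q : ℝ)))) (hin : i < n) :
    |boxSum T i j α (fun _ => 1)| ≤ 2 ^ (i + j) * (2 : ℝ) ^ (-(2 * (q : ℝ))) := by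
  have hlog : 1 + Real.log ((2 : ℝ) ^ (i + 1)) ≤ n + 1 := by
    rw [Real.log_pow]
    have h2 : Real.log 2 ≤ 1 := by have := Real.log_two_lt_d9; linarith
    have h3 : ((i + 1 : ℕ) : ℝ) * Real.log 2 ≤ (i + 1 : ℕ) := by
      have := mul_le_mul_of_nonneg_left h2 (Nat.cast_nonneg (i + 1)); simpa using this
    have h4 : ((i + 1 : ℕ) : ℝ) ≤ n := by exact_mod_cast hin
    linarith
  refine (LiouvilleWalsh.abs_boxSum_le_sqrt_of_divisorBounded T i j hα hF).trans ?_
  refine (cs_numeric le_rfl hlog).trans ?_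
  refine mul_le_mul_of_nonneg_left ?_ (by positivity)
  calc Real.sqrt (2 * ((n : ℝ) + 1) ^ 3 * G) ≤ Real.sqrt ((2 : ℝ) ^ (-(4 * (q : ℝ)))) :=
        Real.sqrt_le_sqrt hG
    _ = (2 : ℝ) ^ (-(2 * (q : ℝ))) := by
        rw [Real.sqrt_eq_rpow, ← Real.rpow_mul (by norm_num)]; ring_nf


set_option maxHeartbeats 800000 in
-- three regimes with shared bookkeeping
/-- **A type-I box, general divisor-bounded coefficient** (the Möbius one is `MoebiusWalsh.typeI_box`): crude regime, refined regime, or — when the top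
`2i + 2` digits carry many elements of `T` — a type-II sum through the signs `ε_a` and Cauchy–Schwarz.
[cite: Bourgain2013MoebiusWalsh, §3 (3.1)–(3.9) and (2.35)] -/
theorem typeI_box_gen {c C : ℝ} (hC : 0 ≤ C)
    (hII : ∀ (i j ρ g₀ K : ℕ) (T : Finset ℕ) (α β : ℕ → ℝ),
      i ≤ j → 1 ≤ g₀ → g₀ ≤ ρ → C * ρ ≤ i →
      (∀ t ∈ T, t < i + j + 2) →
      (K = 0 ∨ i ≤ K + ρ) →
      (K + (ρ + g₀ + 1) + 1 ≤ j ∨ (j + 2 ≤ K + (ρ + g₀ + 1) ∧ K + ρ ≤ j)) →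
      (∀ a, |α a| ≤ 1) → (∀ b, |β b| ≤ 1) →
      |boxSum T i j α β| ≤ 2 ^ (i + j) * ((i : ℝ) + j + 2) ^ C *
        ((2 : ℝ) ^ (-(c * g₀)) + (2 : ℝ) ^ (C * ρ - c * i) +
          (2 : ℝ) ^ (C * ρ - c * ((T.filter (fun t => K ≤ t ∧ t < K + i + (ρ + g₀ + 1))).card : ℝ))))
    {n i j q ρ : ℕ} {M₀ : ℝ} (T : Finset ℕ)
    (hT : ∀ t ∈ T, t < i + j + 2) (hij : i ≤ j) (h2i : 2 * i ≤ j) (hijn : i + j < n)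
    (hq : 1 ≤ q) (hpow : (n : ℝ) + 1 ≤ 2 ^ q) (hpow3 : 2 * ((n : ℝ) + 1) ^ 3 ≤ 2 ^ q) (hρ : 1 ≤ ρ)
    (hM₀T : M₀ ≤ T.card)
    (hE9 : 24 * ((n : ℝ) + 2) ^ 4 * (2 : ℝ) ^ (-(walshSupExponent * M₀ / 2)) ≤ (2 : ℝ) ^ (-(4 * (q : ℝ))))
    (hE11b : 2 * (ρ : ℝ) + 2 ≤ walshSupExponent * M₀ / 2)
    (hE6'' : C * ρ ≤ walshSupExponent * M₀ / 2)
    (h1 : (C + 7) * q ≤ c * ρ)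
    (hE8 : C * ρ + (C + 7) * q ≤
      c * (walshSupExponent * M₀ / (8 * (2 + Real.log ((n : ℝ) + 1) / Real.log 2))))
    {α : ℕ → ℝ} (hα : ∀ a, |α a| ≤ ((σ 0 a : ℕ) : ℝ)) :
    |boxSum T i j α (fun _ => 1)| ≤ 2 ^ (i + j) * (2 : ℝ) ^ (-(2 * (q : ℝ))) := by
  set c₂ := walshSupExponent with hc₂
  set m : ℝ := (T.card : ℝ) with hm
  set Λ : ℕ := i + j + 2 with hΛ
  have h2 : (0 : ℝ) < 2 := by norm_num
  have hl2 : 0 < Real.log 2 := Real.log_pos one_lt_two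
  have hc₂0 : 0 < c₂ := walshSupExponent_pos
  have hq1 : (1 : ℝ) ≤ q := by exact_mod_cast hq
  have hρ1 : (1 : ℝ) ≤ ρ := by exact_mod_cast hρ
  have hc : 0 < c := by
    by_contra hcn
    push Not at hcn
    have : (C + 7) * (q : ℝ) ≤ 0 := h1.trans (mul_nonpos_of_nonpos_of_nonneg hcn (by positivity))
    nlinarith
  have hin : i < n := by omega
  have hn1 : (1 : ℝ) ≤ (n : ℝ) + 1 := by linarith [(Nat.cast_nonneg n : (0 : ℝ) ≤ n)]
  have hM₀0 : 0 < M₀ := by nlinarith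
  have hM₀m : c₂ * M₀ / 2 ≤ c₂ * m / 2 := by gcongr
  -- the bound `G₁` of the two analytic regimes
  have hG₁ : 2 * ((n : ℝ) + 1) ^ 3 * (12 * ((n : ℝ) + 2) * (2 : ℝ) ^ (-(c₂ * m / 2))) ≤
      (2 : ℝ) ^ (-(4 * (q : ℝ))) := by
    refine le_trans ?_ hE9
    have hmono : (2 : ℝ) ^ (-(c₂ * m / 2)) ≤ (2 : ℝ) ^ (-(c₂ * M₀ / 2)) :=
      Real.rpow_le_rpow_of_exponent_le one_le_two (by linarith)
    have hpoly : 2 * ((n : ℝ) + 1) ^ 3 * (12 * ((n : ℝ) + 2)) ≤ 24 * ((n : ℝ) + 2) ^ 4 := by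
      have hn0 : (0 : ℝ) ≤ n := Nat.cast_nonneg n
      have h3 : ((n : ℝ) + 1) ^ 3 ≤ ((n : ℝ) + 2) ^ 3 := by gcongr; linarith
      nlinarith [h3]
    calc 2 * ((n : ℝ) + 1) ^ 3 * (12 * ((n : ℝ) + 2) * (2 : ℝ) ^ (-(c₂ * m / 2)))
        = (2 * ((n : ℝ) + 1) ^ 3 * (12 * ((n : ℝ) + 2))) * (2 : ℝ) ^ (-(c₂ * m / 2)) := by ring
      _ ≤ (24 * ((n : ℝ) + 2) ^ 4) * (2 : ℝ) ^ (-(c₂ * M₀ / 2)) :=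
          mul_le_mul hpoly hmono (by positivity) (by positivity)
      _ = 24 * ((n : ℝ) + 2) ^ 4 * (2 : ℝ) ^ (-(c₂ * M₀ / 2)) := by ring
  by_cases hA : (i : ℝ) ≤ c₂ * m / 2
  · exact typeI_box_of_G_gen T hα (typeI_crude_regime T hT hijn hA) hG₁ hin
  by_cases hB : ((T.filter (fun t => ¬ t < j - i)).card : ℝ) *
      (1 + Real.log (2 * ((i + j + 2 : ℕ) : ℝ)) / Real.log 2) ≤ c₂ * m / 4
  · exact typeI_box_of_G_gen T hα (typeI_refined_regime T hT hij hijn hB) hG₁ hin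
  -- the dense-top regime: a type-II sum
  have hA' := not_le.mp hA
  have hB' := not_le.mp hB
  set θ : ℕ := (T.filter (fun t => ¬ t < j - i)).card with hθ
  have hi_real : c₂ * M₀ / 2 < i := lt_of_le_of_lt hM₀m hA'
  have hρi : 2 * ρ + 2 ≤ i := by
    have : ((2 * ρ + 2 : ℕ) : ℝ) ≤ i := by push_cast; linarith
    exact_mod_cast this
  have hρj : ρ ≤ j := by omega
  have hCi : C * ρ ≤ i := by linarith
  -- the denominators
  set den : ℝ := 2 + Real.log ((n : ℝ) + 1) / Real.log 2 with hden
  set den' : ℝ := 1 + Real.log (2 * ((i + j + 2 : ℕ) : ℝ)) / Real.log 2 with hden'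
  have hlogn1 : 0 ≤ Real.log ((n : ℝ) + 1) := Real.log_nonneg hn1
  have hden2 : 2 ≤ den := by
    have : 0 ≤ Real.log ((n : ℝ) + 1) / Real.log 2 := by positivity
    linarith
  have hden'le : den' ≤ den := by
    have hΛpos : (0 : ℝ) < ((i + j + 2 : ℕ) : ℝ) := by positivity
    have hlogΛ : Real.log (2 * ((i + j + 2 : ℕ) : ℝ)) = Real.log 2 + Real.log ((i + j + 2 : ℕ) : ℝ) :=
      Real.log_mul (by norm_num) hΛpos.ne'
    have hle : Real.log ((i + j + 2 : ℕ) : ℝ) ≤ Real.log ((n : ℝ) + 1) :=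
      Real.log_le_log hΛpos (by exact_mod_cast (show i + j + 2 ≤ n + 1 by omega))
    rw [hden', hden, hlogΛ, add_div, div_self hl2.ne']
    have := div_le_div_of_nonneg_right hle hl2.le
    linarith
  have hden'pos : 0 < den' := by
    have hΛ1 : (1 : ℝ) ≤ 2 * ((i + j + 2 : ℕ) : ℝ) := by
      have : (1 : ℝ) ≤ ((i + j + 2 : ℕ) : ℝ) := by exact_mod_cast (show 1 ≤ i + j + 2 by omega)
      linarith
    have : 0 ≤ Real.log (2 * ((i + j + 2 : ℕ) : ℝ)) / Real.log 2 :=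
      div_nonneg (Real.log_nonneg hΛ1) hl2.le
    rw [hden']; linarith
  -- `c₂ M₀ / (8 den) < θ / 2`
  have hθ_lower : c₂ * M₀ / (8 * den) < (θ : ℝ) / 2 := by
    have h3 : c₂ * M₀ / 4 < (θ : ℝ) * den' := by linarith [hB', hM₀m]
    have h4 : c₂ * M₀ / (8 * den) ≤ c₂ * M₀ / (8 * den') := by
      apply div_le_div_of_nonneg_left (by positivity) (by positivity)
      gcongr
    have h5 : c₂ * M₀ / (8 * den') < (θ : ℝ) / 2 := by
      rw [div_lt_div_iff₀ (by positivity) (by norm_num)]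
      nlinarith
    linarith
  -- `C ρ + (C+7) q ≤ c i`
  have h2' : C * ρ + (C + 7) * q ≤ c * i := by
    refine hE8.trans (mul_le_mul_of_nonneg_left ?_ hc.le)
    have h6 : c₂ * M₀ / (8 * den) ≤ c₂ * M₀ / 16 := by
      apply div_le_div_of_nonneg_left (by positivity) (by norm_num)
      linarith
    linarith
  -- the two candidate windows and the key step
  have key : ∀ K : ℕ, (K = 0 ∨ i ≤ K + ρ) →
      (K + (ρ + ρ + 1) + 1 ≤ j ∨ (j + 2 ≤ K + (ρ + ρ + 1) ∧ K + ρ ≤ j)) →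
      (θ : ℝ) ≤ 2 * ((T.filter (fun t => K ≤ t ∧ t < K + i + (ρ + ρ + 1))).card : ℝ) →
      |boxSum T i j α (fun _ => 1)| ≤ 2 ^ (i + j) * (2 : ℝ) ^ (-(2 * (q : ℝ))) := by
    intro K hK1 hK2 hKd
    set d : ℝ := ((T.filter (fun t => K ≤ t ∧ t < K + i + (ρ + ρ + 1))).card : ℝ) with hd
    have h3' : C * ρ + (C + 7) * q ≤ c * d := by
      refine hE8.trans (mul_le_mul_of_nonneg_left ?_ hc.le)
      linarith
    -- the type-II bound for the signed sum
    have hbox := hII i j ρ ρ K T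
      (fun a => if 0 ≤ ∑ b ∈ dyBlock j, natWalsh T (a * b) then 1 else -1) (fun _ => 1)
      hij hρ le_rfl hCi hT hK1 hK2 (fun a => abs_sign_le_one T j a) (fun _ => by simp)
    rw [← sum_abs_eq_boxSum_sign, ← hd] at hbox
    have hL1 : (1 : ℝ) ≤ (i : ℝ) + j + 2 := by
      have : (0 : ℝ) ≤ (i : ℝ) + j := by positivity
      linarith
    have hL : (i : ℝ) + j + 2 ≤ (2 : ℝ) ^ q := by
      have : ((i + j : ℕ) : ℝ) + 1 ≤ n := by exact_mod_cast hijn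
      push_cast at this
      linarith
    have hthree := three_terms_le (d := d) hC hq hL1 hL h1 h2' h3'
    have hF : ∑ a ∈ dyBlock i, |∑ b ∈ dyBlock j, natWalsh T (a * b)| ≤
        2 ^ (i + j) * (2 : ℝ) ^ (-(5 * (q : ℝ))) := by
      refine (le_abs_self _).trans (hbox.trans ?_)
      rw [mul_assoc]
      exact mul_le_mul_of_nonneg_left hthree (by positivity)
    have hG₂ : 2 * ((n : ℝ) + 1) ^ 3 * (2 : ℝ) ^ (-(5 * (q : ℝ))) ≤ (2 : ℝ) ^ (-(4 * (q : ℝ))) := by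
      have e : (2 : ℝ) ^ (-(4 * (q : ℝ))) = (2 : ℝ) ^ q * (2 : ℝ) ^ (-(5 * (q : ℝ))) := by
        rw [← Real.rpow_natCast, ← Real.rpow_add h2]; ring_nf
      rw [e]
      exact mul_le_mul_of_nonneg_right hpow3 (by positivity)
    exact typeI_box_of_G_gen T hα hF hG₂ hin
  -- the top block splits between the two windows
  have htop := card_top_le_two_windows T hij hρ hρj hT
  have e2ρ : ρ + ρ + 1 = 2 * ρ + 1 := by ring
  rcases le_total ((T.filter (fun t => j - ρ ≤ t ∧ t < (j - ρ) + i + (2 * ρ + 1))).card)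
      ((T.filter (fun t => j - i ≤ t ∧ t < (j - i) + i + (2 * ρ + 1))).card) with hle | hle
  · -- the middle window `K = j - i`
    refine key (j - i) (Or.inr (by omega)) (Or.inl (by omega)) ?_
    rw [e2ρ]
    have : θ ≤ 2 * (T.filter (fun t => j - i ≤ t ∧ t < (j - i) + i + (2 * ρ + 1))).card := by omega
    exact_mod_cast this
  · -- the top window `K = j - ρ`
    refine key (j - ρ) (Or.inr (by omega)) (Or.inr ⟨by omega, by omega⟩) ?_
    rw [e2ρ]
    have : θ ≤ 2 * (T.filter (fun t => j - ρ ≤ t ∧ t < (j - ρ) + i + (2 * ρ + 1))).card := by omega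
    exact_mod_cast this



/-! ### The final numerical step for `λ` -/

/-- **From the `λ`-criterion's bound to `2^{n - n^{1/10}}`** (the square term `u⌊√2ⁿ⌋` replaces `u`). [folklore] -/
theorem final_numeric_liouville {n q : ℕ} (hq : 1 ≤ q) (h3q : 3 * q ≤ n) (hn72 : 72 ≤ n)
    (hE1 : 8 * ((n : ℝ) + 1) ^ 4 * (2 : ℝ) ^ ((n : ℝ) ^ ((1 : ℝ) / 10)) < (2 : ℝ) ^ q) {W : ℝ}
    (hW : W ≤ (((2 ^ (n / 8) : ℕ) : ℝ) + (Nat.sqrt (2 ^ n) : ℝ) * ((2 ^ (n / 8) : ℕ) : ℝ)) +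
      (n : ℝ) ^ 2 * (2 ^ n * (2 : ℝ) ^ (-(2 * (q : ℝ))) + 2 ^ (n - 3 * q) * (n + 1)) +
      ((2 ^ q : ℕ) : ℝ) * ((n : ℝ) ^ 2 * (2 ^ n * (2 : ℝ) ^ (-(5 * (q : ℝ))) + 2 ^ (n - 3 * q))) +
      2 ^ n * ((n : ℝ) + 1) ^ 4 / ((2 ^ q : ℕ) : ℝ)) :
    W < (2 : ℝ) ^ ((n : ℝ) - (n : ℝ) ^ ((1 : ℝ) / 10)) := by
  have h2 : (0 : ℝ) < 2 := by norm_num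
  set t : ℝ := (2 : ℝ) ^ q with ht
  set N : ℝ := (2 : ℝ) ^ n with hN
  set y : ℝ := (n : ℝ) ^ ((1 : ℝ) / 10) with hy
  have ht2 : 2 ≤ t := by
    calc (2 : ℝ) = 2 ^ 1 := by norm_num
      _ ≤ 2 ^ q := pow_le_pow_right₀ one_le_two hq
  have ht0 : 0 < t := by positivity
  have hN0 : 0 < N := by positivity
  have hn0 : (0 : ℝ) ≤ n := Nat.cast_nonneg n
  push_cast at hW
  -- the rpow savings in terms of `t`
  have hr2 : (2 : ℝ) ^ (-(2 * (q : ℝ))) = 1 / t ^ 2 := by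
    rw [Real.rpow_neg h2.le, ht, ← Real.rpow_natCast, ← Real.rpow_natCast, ← Real.rpow_mul h2.le,
      one_div]
    push_cast; ring_nf
  have hr5 : (2 : ℝ) ^ (-(5 * (q : ℝ))) = 1 / t ^ 5 := by
    rw [Real.rpow_neg h2.le, ht, ← Real.rpow_natCast, ← Real.rpow_natCast, ← Real.rpow_mul h2.le,
      one_div]
    push_cast; ring_nf
  have hr3 : (2 : ℝ) ^ (n - 3 * q) = N / t ^ 3 := by
    rw [hN, ht, ← pow_mul, pow_sub₀ _ (by norm_num) (by omega)]
    ring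
  have hu : (2 : ℝ) ^ (n / 8) + (Nat.sqrt (2 ^ n) : ℝ) * (2 : ℝ) ^ (n / 8) ≤ N / t := by
    have hsq : Nat.sqrt (2 ^ n) ≤ 2 ^ ((n + 1) / 2) := by
      have h1 : 2 ^ n ≤ 2 ^ ((n + 1) / 2) * 2 ^ ((n + 1) / 2) := by
        rw [← pow_add]; exact Nat.pow_le_pow_right (by norm_num) (by omega)
      calc Nat.sqrt (2 ^ n) ≤ Nat.sqrt (2 ^ ((n + 1) / 2) * 2 ^ ((n + 1) / 2)) := Nat.sqrt_le_sqrt h1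
        _ = 2 ^ ((n + 1) / 2) := Nat.sqrt_eq _
    have hsq' : (Nat.sqrt (2 ^ n) : ℝ) ≤ (2 : ℝ) ^ ((n + 1) / 2) := by exact_mod_cast hsq
    have h1 : (1 : ℝ) ≤ (2 : ℝ) ^ ((n + 1) / 2) := one_le_pow₀ one_le_two
    have h2 : (2 : ℝ) ^ (n / 8) + (Nat.sqrt (2 ^ n) : ℝ) * (2 : ℝ) ^ (n / 8) ≤
        2 * (2 : ℝ) ^ ((n + 1) / 2) * (2 : ℝ) ^ (n / 8) := by
      have h3 := mul_le_mul_of_nonneg_right hsq' (show (0 : ℝ) ≤ 2 ^ (n / 8) by positivity)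
      have h4 := mul_le_mul_of_nonneg_right h1 (show (0 : ℝ) ≤ 2 ^ (n / 8) by positivity)
      linarith
    refine h2.trans ?_
    rw [le_div_iff₀ ht0, hN, ht, ← pow_succ', ← pow_add, ← pow_add]
    exact pow_le_pow_right₀ one_le_two (by omega)
  rw [hr2, hr5, hr3] at hW
  -- every term is `≤ (n+1)^4 N / t`
  have hn1 : (1 : ℝ) ≤ (n : ℝ) + 1 := by linarith
  have hP4 : (1 : ℝ) ≤ ((n : ℝ) + 1) ^ 4 := one_le_pow₀ hn1
  have hn2 : (n : ℝ) ^ 2 ≤ ((n : ℝ) + 1) ^ 4 := by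
    calc (n : ℝ) ^ 2 ≤ ((n : ℝ) + 1) ^ 2 := by gcongr; linarith
      _ ≤ ((n : ℝ) + 1) ^ 4 := pow_le_pow_right₀ hn1 (by norm_num)
  have hn3 : (n : ℝ) ^ 2 * (n + 1) ≤ ((n : ℝ) + 1) ^ 4 := by
    calc (n : ℝ) ^ 2 * (n + 1) ≤ ((n : ℝ) + 1) ^ 2 * (n + 1) := by gcongr; linarith
      _ = ((n : ℝ) + 1) ^ 3 := by ring
      _ ≤ ((n : ℝ) + 1) ^ 4 := pow_le_pow_right₀ hn1 (by norm_num)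
  have hinv : ∀ k : ℕ, 1 ≤ k → N / t ^ k ≤ N / t := by
    intro k hk
    apply div_le_div_of_nonneg_left hN0.le ht0
    calc t = t ^ 1 := (pow_one t).symm
      _ ≤ t ^ k := pow_le_pow_right₀ (by linarith) hk
  have hb : (n : ℝ) ^ 2 * (N * (1 / t ^ 2) + N / t ^ 3 * (n + 1)) ≤ 2 * (((n : ℝ) + 1) ^ 4 * (N / t)) := by
    have e1 : (n : ℝ) ^ 2 * (N * (1 / t ^ 2) + N / t ^ 3 * (n + 1)) =
        (n : ℝ) ^ 2 * (N / t ^ 2) + (n : ℝ) ^ 2 * (n + 1) * (N / t ^ 3) := by ring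
    rw [e1]
    have := hinv 2 (by norm_num)
    have := hinv 3 (by norm_num)
    nlinarith [mul_le_mul hn2 (hinv 2 (by norm_num)) (by positivity) (by positivity),
      mul_le_mul hn3 (hinv 3 (by norm_num)) (by positivity) (by positivity)]
  have hd : t * ((n : ℝ) ^ 2 * (N * (1 / t ^ 5) + N / t ^ 3)) ≤ 2 * (((n : ℝ) + 1) ^ 4 * (N / t)) := by
    have e1 : t * ((n : ℝ) ^ 2 * (N * (1 / t ^ 5) + N / t ^ 3)) =
        (n : ℝ) ^ 2 * (N / t ^ 4) + (n : ℝ) ^ 2 * (N / t ^ 2) := by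
      field_simp
    rw [e1]
    nlinarith [mul_le_mul hn2 (hinv 4 (by norm_num)) (by positivity) (by positivity),
      mul_le_mul hn2 (hinv 2 (by norm_num)) (by positivity) (by positivity)]
  have hf : N * ((n : ℝ) + 1) ^ 4 / t = ((n : ℝ) + 1) ^ 4 * (N / t) := by ring
  have hall : W ≤ 6 * (((n : ℝ) + 1) ^ 4 * (N / t)) := by
    have ha : (2 : ℝ) ^ (n / 8) + (Nat.sqrt (2 ^ n) : ℝ) * (2 : ℝ) ^ (n / 8) ≤ ((n : ℝ) + 1) ^ 4 * (N / t) := by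
      have := mul_le_mul_of_nonneg_right hP4 (show 0 ≤ N / t by positivity)
      linarith
    linarith [hW, ha, hb, hd, hf.le, hf.ge]
  -- and `8 (n+1)^4 N / t < 2^{n - y}`
  have hfin : 8 * (((n : ℝ) + 1) ^ 4 * (N / t)) < (2 : ℝ) ^ ((n : ℝ) - y) := by
    rw [Real.rpow_sub h2, Real.rpow_natCast, ← hN]
    rw [lt_div_iff₀ (by positivity)]
    calc 8 * (((n : ℝ) + 1) ^ 4 * (N / t)) * (2 : ℝ) ^ y = (8 * ((n : ℝ) + 1) ^ 4 * (2 : ℝ) ^ y) * N / t := by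
          ring
      _ < t * N / t := by gcongr
      _ = N := by field_simp
  have hpos : 0 ≤ ((n : ℝ) + 1) ^ 4 * (N / t) := by positivity
  linarith


/-! ### The main theorem for `λ` -/

set_option maxHeartbeats 1600000 in
-- the assembly: many cases, one shared context
/-- **Bourgain 2013, Theorem 1 for the Liouville function, conditionally on the type-II box bound**
("(a similar estimate is also valid for the Liouville function)"): the same hypothesis as in
`MoebiusWalsh.bourgain_moebius_walsh_uniform_of_typeII` (Bourgain's (2.29) for the dyadic box sums of
Walsh characters with `1`-bounded coefficients — a statement about Walsh functions, not about `μ` or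
`λ`) implies the named fact `bourgain_liouville_walsh_uniform`. Same schedule and the same per-box
lemmas; the differences are the Vaughan reduction (`LiouvilleWalshVaughan`, with its extra square term
`u⌊√2ⁿ⌋`, through `LiouvilleWalsh.abs_walshSum_liouville_le_of_boxBounds`), the coefficient sequences
`liouvTypeICoeff` (`|·| ≤ τ`) and `liouvTypeIICoeffB` (`|·| ≤ 1`), and the Green side for `λ`
(`green_liouville_fourierWalsh_holds`, `Green2012.liouville_walshSum_empty_le`).
[cite: Bourgain2013MoebiusWalsh, Theorem 1 (remark on λ) and §§2–3] -/
theorem bourgain_liouville_walsh_uniform_of_typeII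
    (hII : ∃ c : ℝ, 0 < c ∧ ∃ C : ℝ, 0 ≤ C ∧
      ∀ (i j ρ g₀ K : ℕ) (T : Finset ℕ) (α β : ℕ → ℝ),
      i ≤ j → 1 ≤ g₀ → g₀ ≤ ρ → C * ρ ≤ i →
      (∀ t ∈ T, t < i + j + 2) →
      (K = 0 ∨ i ≤ K + ρ) →
      (K + (ρ + g₀ + 1) + 1 ≤ j ∨ (j + 2 ≤ K + (ρ + g₀ + 1) ∧ K + ρ ≤ j)) →
      (∀ a, |α a| ≤ 1) → (∀ b, |β b| ≤ 1) →
      |boxSum T i j α β| ≤ 2 ^ (i + j) * ((i : ℝ) + j + 2) ^ C *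
        ((2 : ℝ) ^ (-(c * g₀)) + (2 : ℝ) ^ (C * ρ - c * i) +
          (2 : ℝ) ^ (C * ρ - c * ((T.filter (fun t => K ≤ t ∧ t < K + i + (ρ + g₀ + 1))).card : ℝ)))) :
    bourgain_liouville_walsh_uniform := by
  classical
  obtain ⟨c, hc, C, hC, hII⟩ := hII
  obtain ⟨cG, hcG, KG, hG⟩ := green_liouville_fourierWalsh_holds
  have hev := (schedule_eventually hc hC walshSupExponent_pos hcG KG).and (eventually_ge_atTop 72)
  obtain ⟨n₀, hn₀⟩ := Filter.eventually_atTop.1 hev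
  refine ⟨n₀, fun n hn A => ?_⟩
  obtain ⟨⟨⟨hn16, hq1, hs1⟩, hE1, ⟨hE2, hE4, hE11a, hE13⟩, hE10, hE5, hE5', ⟨hE6, hE6', hE6'', hρge⟩,
    hE7, hE8, hE9, ⟨hE11b, hM₀0⟩⟩, hn72⟩ := hn₀ n hn
  set q : ℕ := Nat.sqrt (Nat.sqrt (Nat.sqrt n)) with hqdef
  set s : ℕ := Nat.sqrt n with hsdef
  set ρ : ℕ := ⌈(C + 7) * (q : ℝ) / c⌉₊ with hρdef
  set M₀ : ℝ := (s : ℝ) / q - 1 - 3 * q with hM₀def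
  have hq1r : (1 : ℝ) ≤ q := by exact_mod_cast hq1
  have hρ1 : 1 ≤ ρ := by
    have h : (0 : ℝ) < c * ρ := lt_of_lt_of_le (by positivity) hρge
    have h' : (0 : ℝ) < ρ := pos_of_mul_pos_right h hc.le
    exact_mod_cast h'
  have hE3 : (n : ℝ) + 1 ≤ (2 : ℝ) ^ q := by
    have : ((n : ℝ) + 1) ^ 3 ≥ (n : ℝ) + 1 := le_self_pow₀ (by linarith [(Nat.cast_nonneg n : (0:ℝ) ≤ n)]) (by norm_num)
    linarith
  -- the three cases on `|A|`
  rcases A.eq_empty_or_nonempty with rfl | hAne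
  · -- `A = ∅`
    exact green_empty_liouville hcG hG hE5'
  by_cases hsmall : A.card ≤ s / q
  · -- few digits: Green
    refine green_small_gen (hG n (by omega)) hcG A hAne ?_ hE5
    have h1 : A.card * q ≤ s := (Nat.mul_le_mul_right q hsmall).trans (Nat.div_mul_le_self s q)
    have h2 : ((A.card * q : ℕ) : ℝ) ≤ s := by exact_mod_cast h1
    push_cast at h2
    refine h2.trans ?_
    rw [hsdef]
    have h3 : ((Nat.sqrt n : ℕ) : ℝ) ^ 2 ≤ n := by exact_mod_cast Nat.sqrt_le' n
    exact Real.le_sqrt_of_sq_le h3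
  -- many digits: Vaughan's identity and the boxes
  have hAcard : s / q + 1 ≤ A.card := by omega
  have hB1 : 1 ≤ 2 ^ q := Nat.one_le_two_pow
  have hkey := LiouvilleWalsh.abs_walshSum_liouville_le_of_boxBounds n (2 ^ (n / 8)) (2 ^ q) (3 * q) hB1 A
    (EI := 2 ^ n * (2 : ℝ) ^ (-(2 * (q : ℝ)))) (EII := 2 ^ n * (2 : ℝ) ^ (-(5 * (q : ℝ))))
    (by positivity) (by positivity) ?_ ?_
  · exact final_numeric_liouville hq1 hE4 hn72 hE1 hkey
  · -- TYPE I boxes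
    intro T hT i j hijn hlarge
    by_cases hi : i ≤ 2 * (n / 8)
    · have hij : i ≤ j := by omega
      have h2i : 2 * i ≤ j := by omega
      rw [boxSum_eq_boxSum_filter T (le_refl (i + j + 2))]
      set T' := T.filter (· < i + j + 2) with hT'def
      have hT' : ∀ t ∈ T', t < i + j + 2 := fun t ht => (Finset.mem_filter.mp ht).2
      have hM₀T : M₀ ≤ T'.card := M₀_le_card_cut A hT hlarge hq1 hAcard
      have hbox := typeI_box_gen hC hII T' hT' hij h2i hijn hq1 hE3 hE10 hρ1 hM₀T hE9 hE11b hE6'' hρge hE8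
        (liouvHα (2 ^ (n / 8)))
      refine hbox.trans ?_
      exact mul_le_mul_of_nonneg_right (pow_le_pow_right₀ one_le_two (by omega)) (by positivity)
    · -- `a > u²`: the coefficient vanishes on the block
      have hzero : boxSum T i j (liouvTypeICoeff (2 ^ (n / 8))) (fun _ => 1) = 0 := by
        unfold boxSum
        refine Finset.sum_eq_zero fun a ha => Finset.sum_eq_zero fun b _ => ?_
        rw [mem_dyBlock] at ha
        have hu : 2 ^ (n / 8) * 2 ^ (n / 8) < a := by
          rw [← pow_add]
          exact lt_of_lt_of_le (Nat.pow_lt_pow_right (by norm_num) (by omega)) ha.1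
        rw [liouvTypeICoeff_eq_zero hu]; ring
      rw [hzero, abs_zero]; positivity
  · -- TYPE II boxes
    intro T hT i j hijn hlarge
    have hαb : ∀ a, |typeIICoeffA (2 ^ (n / 8)) (2 ^ q) a| ≤ 1 :=
      fun a => MoebiusWalshVaughan.abs_typeIICoeffA_le hB1 _ a
    have hβb : ∀ b, |liouvTypeIICoeffB (2 ^ (n / 8)) b| ≤ 1 := abs_liouvTypeIICoeffB_le _
    by_cases hi : n / 8 ≤ i
    · by_cases hj : n / 8 ≤ j
      · rw [boxSum_eq_boxSum_filter T (le_refl (i + j + 2))]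
        set T' := T.filter (· < i + j + 2) with hT'def
        have hT' : ∀ t ∈ T', t < i + j + 2 := fun t ht => (Finset.mem_filter.mp ht).2
        have hM₀T : M₀ ≤ T'.card := M₀_le_card_cut A hT hlarge hq1 hAcard
        have h3 : C * ρ + (C + 7) * q ≤ c * ((T'.card : ℝ) / 24) :=
          hE7.trans (mul_le_mul_of_nonneg_left (by linarith) hc.le)
        have h2n : (2 : ℝ) ^ (i + j) ≤ 2 ^ n := pow_le_pow_right₀ one_le_two (by omega)
        rcases le_total i j with hij | hji
        · have hbox := typeII_box hC hII T' hT' hij hi hijn hn16 hq1 hE3 hρ1 hE13 hE6' hρge hE6 h3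
            _ _ hαb hβb
          exact hbox.trans (mul_le_mul_of_nonneg_right h2n (by positivity))
        · rw [boxSum_comm]
          have hT'' : ∀ t ∈ T', t < j + i + 2 := fun t ht => by have := hT' t ht; omega
          have h3' : C * ρ + (C + 7) * q ≤ c * ((T'.card : ℝ) / 24) := h3
          have hbox := typeII_box hC hII T' hT'' hji hj (by omega) hn16 hq1 hE3 hρ1 hE13 hE6' hρge hE6 h3'
            _ _ hβb hαb
          refine hbox.trans ?_
          rw [add_comm j i]
          exact mul_le_mul_of_nonneg_right h2n (by positivity)
      · -- `b ≤ u`: `β = μ - μ_u` vanishes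
        have hzero : boxSum T i j (typeIICoeffA (2 ^ (n / 8)) (2 ^ q)) (liouvTypeIICoeffB (2 ^ (n / 8))) = 0 := by
          unfold boxSum
          refine Finset.sum_eq_zero fun a _ => Finset.sum_eq_zero fun b hb => ?_
          rw [mem_dyBlock] at hb
          have hbu : b ≤ 2 ^ (n / 8) :=
            (le_of_lt hb.2).trans (Nat.pow_le_pow_right (by norm_num) (by omega))
          rw [liouvTypeIICoeffB_eq_zero hbu]; ring
        rw [hzero, abs_zero]; positivity
    · -- `a ≤ u`: `α` vanishes
      have hzero : boxSum T i j (typeIICoeffA (2 ^ (n / 8)) (2 ^ q)) (liouvTypeIICoeffB (2 ^ (n / 8))) = 0 := by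
        unfold boxSum
        refine Finset.sum_eq_zero fun a ha => Finset.sum_eq_zero fun b _ => ?_
        rw [mem_dyBlock] at ha
        have hau : a ≤ 2 ^ (n / 8) :=
          (le_of_lt ha.2).trans (Nat.pow_le_pow_right (by norm_num) (by omega))
        rw [MoebiusWalshVaughan.typeIICoeffA_eq_zero (2 ^ q) hau]; ring
      rw [hzero, abs_zero]; positivity

end Literature.NumberTheory.LFunctions.MoebiusWalsh
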